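import Mathlib
import Summits.CriticalPhenomena.PercolationContinuityZ3.Theorems.PercNearOneGluingNoHeavyLowerTailObserverUnionBoundG
import Summits.CriticalPhenomena.PercolationContinuityZ3.Theorems.PercNearOneGluingNoHeavyLowerTailPrefixPackingTwo
import Literature.Probability.LatticeModels.ProdBernoulliAtomExpansion
import HarnessLib

/-!
# `NoHeavyLowerTail` (stmt-CriticalPhenomena-4575) — CONDITIONAL cumulative isolation for Steiner paths, I:
# the route bound, the attachment lower bound, and the base case (a weight-one chain with relay hairs)

Seat `prim-cplus-engine` gen 7, 2026-08-19 (`--supports stmt-CriticalPhenomena-4575`).  No definitions, no named facts,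
no sorries.  Notation as in `…CILSteinerPath.lean`: `μ_w = prodBernoulli w`, relays `A`, an injective Steiner path
`p : Fin (k+1) → Fin n` off `A` whose vertices have, apart from relays (hairs, arbitrary weights), no positive-weight
non-relay neighbour other than their path neighbours; observer `p 0`; `N_v = |{a ∈ A : v ↔ a}|`; a champion `c`
(`μ(N_a ≤ j) ≤ μ(N_c ≤ j)` on `A`).

The tree's `cil_steinerPath` is the UNCONDITIONAL bound `μ(1 ≤ N_{p 0} ≤ j) ≤ μ(N_c ≤ j)`.  The CONDITIONAL form
multiplies the right-hand side by the attachment probability `μ(p 0 ↔ A)` (Kozma–Nitzan's post-FKG shape), which is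
what a many-legged observer needs when its legs are individually unreliable (`…MarkovFirstEdgeSpider.lean`, READING).

* `CondCIL.firstRelay_on_path` — outside the null event "some weight-`0` pair is open", an open walk from a path vertex
  to a relay leaves the path through an open HAIR `s(p l, a)`.
* `CondCIL.lowerTail_le_hairWeight_mul` — **route bound** (any Steiner path):
      `μ(1 ≤ N_{p 0} ≤ j) ≤ (Σ_l Σ_{a∈A} w(p l, a)) · μ(N_c ≤ j)`     (union over hairs + Harris).
* `CondCIL.attach_ge_chain` — if all path pairs have weight `1`:  `1 − exp(−Σ_l Σ_a w(p l, a)) ≤ μ(p 0 ↔ A)`.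
* `CondCIL.condCIL_chain` — **base case**: all path pairs of weight `1` ⇒
      `μ(1 ≤ N_{p 0} ≤ j) ≤ 3 · μ(p 0 ↔ A) · μ(N_c ≤ j)`
  (hair weight `H ≤ 1/2`: route bound `H·M` against `μ(att) ≥ 1 − e^{−H} ≥ H/2`; `H > 1/2`: `cil_steinerPath` against
  `μ(att) ≥ 1 − e^{−1/2} ≥ 1/3`).
The induction over the path pairs of weight `< 1` (open: pin to `1`; closed: delete and fall back on the base case for
the prefix) is in the sequel `…CondCILSteinerPath.lean`.
-/

namespace Summit.CriticalPhenomena.PercolationContinuityZ3.Theorems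

open MeasureTheory Set
open Literature.Probability.LatticeModels (prodBernoulli prodBernoulli_real_setOf_mem prodBernoulli_real_forall_notMem
  prodBernoulli_harris_upper_lower prodBernoulli_setOf_exists_mem_eq_zero prodBernoulli_real_setOf_notMem)
open Literature.Probability.Percolation

noncomputable section
open Classical

variable {n : ℕ}

namespace CondCIL

/-! ### Walks along a Steiner path -/

/-- **First relay on a walk.**  Let `p` be a Steiner path (positive-weight non-relay neighbours of `p i` other than
`p i` are path neighbours) and let `ω` open no pair of weight `0`.  An open walk from a path vertex `u = p i` to a
relay reaches its first relay `a` through an open hair `s(p l, a)`, and `u ↔ a`. [this work] -/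
theorem firstRelay_on_path (w : Sym2 (Fin n) → unitInterval) (A : Finset (Fin n)) {k : ℕ}
    (p : Fin (k + 1) → Fin n) (hpA : ∀ i, p i ∉ A)
    (hpath : ∀ (i : Fin (k + 1)) (v : Fin n), v ∉ A → v ≠ p i → 0 < (w s(p i, v) : ℝ) →
      ∃ l : Fin (k + 1), v = p l ∧ (l.val = i.val + 1 ∨ i.val = l.val + 1))
    {ω : BondConfig (Fin n)} (hω : ∀ e ∈ ω, (w e : ℝ) ≠ 0) :
    ∀ {u x : Fin n} (_ : (openGraph ω).Walk u x), (∃ i, u = p i) → x ∈ A →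
      ∃ l : Fin (k + 1), ∃ a ∈ A, s(p l, a) ∈ ω ∧ (openGraph ω).Reachable u a
  | _, _, .nil => fun ⟨i, hi⟩ hx => absurd hx (hi ▸ hpA i)
  | u, x, .cons (v := v) hadj q => fun ⟨i, hi⟩ hx => by
      have huv : s(u, v) ∈ ω ∧ u ≠ v := (openGraph_adj ω u v).1 hadj
      by_cases hvA : v ∈ A
      · exact ⟨i, v, hvA, hi ▸ huv.1, hadj.reachable⟩
      · have hpos : 0 < (w s(p i, v) : ℝ) := by
          rw [← hi]
          exact lt_of_le_of_ne (w s(u, v)).2.1 (Ne.symm (hω _ huv.1))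
        obtain ⟨l', hvl', -⟩ := hpath i v hvA (fun h => huv.2 (hi.trans h.symm)) hpos
        obtain ⟨l, a, haA, hla, hva⟩ := firstRelay_on_path w A p hpA hpath hω q ⟨l', hvl'⟩ hx
        exact ⟨l, a, haA, hla, hadj.reachable.trans hva⟩

/-- **Route inclusion.**  For a Steiner path observer `p 0`:
`{1 ≤ N_{p 0} ≤ j} ⊆ (⋃_{(l,a)} {s(p l, a) open} ∩ {N_a ≤ j}) ∪ {some weight-0 pair open}`. [this work] -/
theorem lowerTail_subset_routes (w : Sym2 (Fin n) → unitInterval) (A : Finset (Fin n)) (j : ℕ) {k : ℕ}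
    (p : Fin (k + 1) → Fin n) (hpA : ∀ i, p i ∉ A)
    (hpath : ∀ (i : Fin (k + 1)) (v : Fin n), v ∉ A → v ≠ p i → 0 < (w s(p i, v) : ℝ) →
      ∃ l : Fin (k + 1), v = p l ∧ (l.val = i.val + 1 ∨ i.val = l.val + 1)) :
    {ω : BondConfig (Fin n) | 1 ≤ (A.filter fun z => ω ∈ openConn (p 0) z).card ∧
        (A.filter fun z => ω ∈ openConn (p 0) z).card ≤ j} ⊆
      (⋃ la ∈ (Finset.univ : Finset (Fin (k + 1))) ×ˢ A,
        ({ω : BondConfig (Fin n) | s(p la.1, la.2) ∈ ω} ∩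
          {ω : BondConfig (Fin n) | (A.filter fun z => ω ∈ openConn la.2 z).card ≤ j})) ∪
      {ω : BondConfig (Fin n) | ∃ e ∈ (Finset.univ.filter fun e : Sym2 (Fin n) => (w e : ℝ) = 0), e ∈ ω} := by
  intro ω hω
  obtain ⟨h1, hj⟩ := hω
  by_cases hnull : ∃ e ∈ (Finset.univ.filter fun e : Sym2 (Fin n) => (w e : ℝ) = 0), e ∈ ω
  · exact Or.inr hnull
  left
  have hω0 : ∀ e ∈ ω, (w e : ℝ) ≠ 0 := by
    intro e he h0
    exact hnull ⟨e, Finset.mem_filter.2 ⟨Finset.mem_univ _, h0⟩, he⟩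
  obtain ⟨x, hx⟩ := Finset.card_pos.1 h1
  obtain ⟨hxA, hox⟩ := Finset.mem_filter.1 hx
  obtain ⟨q⟩ := (hox : (openGraph ω).Reachable (p 0) x)
  obtain ⟨l, a, haA, hla, hpa⟩ := firstRelay_on_path w A p hpA hpath hω0 q ⟨0, rfl⟩ hxA
  rw [Set.mem_iUnion₂]
  refine ⟨(l, a), Finset.mem_product.2 ⟨Finset.mem_univ _, haA⟩, hla, ?_⟩
  -- relays of `a` are relays of `p 0`
  refine le_trans (Finset.card_le_card fun z hz => ?_) hj
  rw [Finset.mem_filter] at hz ⊢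
  exact ⟨hz.1, (hpa.trans hz.2 : (openGraph ω).Reachable (p 0) z)⟩

/-- **Route bound** (any Steiner path, every champion `c`):
`μ(1 ≤ N_{p 0} ≤ j) ≤ (Σ_{l} Σ_{a ∈ A} w(p l, a)) · μ(N_c ≤ j)`. [this work] -/
theorem lowerTail_le_hairWeight_mul (w : Sym2 (Fin n) → unitInterval) (A : Finset (Fin n)) (j : ℕ) {k : ℕ}
    (p : Fin (k + 1) → Fin n) (hpA : ∀ i, p i ∉ A)
    (hpath : ∀ (i : Fin (k + 1)) (v : Fin n), v ∉ A → v ≠ p i → 0 < (w s(p i, v) : ℝ) →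
      ∃ l : Fin (k + 1), v = p l ∧ (l.val = i.val + 1 ∨ i.val = l.val + 1))
    (c : Fin n) (hchamp : ∀ a ∈ A,
      (prodBernoulli w).real {ω : BondConfig (Fin n) | (A.filter fun z => ω ∈ openConn a z).card ≤ j} ≤
        (prodBernoulli w).real {ω : BondConfig (Fin n) | (A.filter fun z => ω ∈ openConn c z).card ≤ j}) :
    (prodBernoulli w).real {ω : BondConfig (Fin n) | 1 ≤ (A.filter fun z => ω ∈ openConn (p 0) z).card ∧
        (A.filter fun z => ω ∈ openConn (p 0) z).card ≤ j} ≤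
      (∑ la ∈ (Finset.univ : Finset (Fin (k + 1))) ×ˢ A, (w s(p la.1, la.2) : ℝ)) *
        (prodBernoulli w).real {ω : BondConfig (Fin n) | (A.filter fun z => ω ∈ openConn c z).card ≤ j} := by
  set μ := prodBernoulli w with hμ
  set Z : Finset (Sym2 (Fin n)) := Finset.univ.filter fun e : Sym2 (Fin n) => (w e : ℝ) = 0 with hZ
  have hnull : μ.real {ω : BondConfig (Fin n) | ∃ e ∈ Z, e ∈ ω} = 0 := by
    rw [measureReal_def, prodBernoulli_setOf_exists_mem_eq_zero w Z fun e he => (Finset.mem_filter.1 he).2,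
      ENNReal.toReal_zero]
  have hterm : ∀ la ∈ (Finset.univ : Finset (Fin (k + 1))) ×ˢ A,
      μ.real ({ω : BondConfig (Fin n) | s(p la.1, la.2) ∈ ω} ∩
          {ω : BondConfig (Fin n) | (A.filter fun z => ω ∈ openConn la.2 z).card ≤ j}) ≤
        (w s(p la.1, la.2) : ℝ) *
          μ.real {ω : BondConfig (Fin n) | (A.filter fun z => ω ∈ openConn c z).card ≤ j} := by
    intro la hla
    have ha : la.2 ∈ A := (Finset.mem_product.1 hla).2
    have hup : IsUpperSet {ω : BondConfig (Fin n) | s(p la.1, la.2) ∈ ω} := fun ω ω' hle hω => hle hω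
    refine (prodBernoulli_harris_upper_lower w hup (PrefixPacking.isLowerSet_cardLe A la.2 j) MeasurableSet.of_discrete
      MeasurableSet.of_discrete).trans ?_
    rw [prodBernoulli_real_setOf_mem]
    exact mul_le_mul_of_nonneg_left (hchamp la.2 ha) (w _).2.1
  calc μ.real {ω : BondConfig (Fin n) | 1 ≤ (A.filter fun z => ω ∈ openConn (p 0) z).card ∧
          (A.filter fun z => ω ∈ openConn (p 0) z).card ≤ j}
      ≤ μ.real ((⋃ la ∈ (Finset.univ : Finset (Fin (k + 1))) ×ˢ A,
          ({ω : BondConfig (Fin n) | s(p la.1, la.2) ∈ ω} ∩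
            {ω : BondConfig (Fin n) | (A.filter fun z => ω ∈ openConn la.2 z).card ≤ j})) ∪
          {ω : BondConfig (Fin n) | ∃ e ∈ Z, e ∈ ω}) :=
        measureReal_mono (lowerTail_subset_routes w A j p hpA hpath) (measure_ne_top _ _)
    _ ≤ μ.real (⋃ la ∈ (Finset.univ : Finset (Fin (k + 1))) ×ˢ A,
          ({ω : BondConfig (Fin n) | s(p la.1, la.2) ∈ ω} ∩
            {ω : BondConfig (Fin n) | (A.filter fun z => ω ∈ openConn la.2 z).card ≤ j})) +
          μ.real {ω : BondConfig (Fin n) | ∃ e ∈ Z, e ∈ ω} := measureReal_union_le _ _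
    _ ≤ (∑ la ∈ (Finset.univ : Finset (Fin (k + 1))) ×ˢ A,
          μ.real ({ω : BondConfig (Fin n) | s(p la.1, la.2) ∈ ω} ∩
            {ω : BondConfig (Fin n) | (A.filter fun z => ω ∈ openConn la.2 z).card ≤ j})) + 0 := by
        rw [hnull]; exact add_le_add (measureReal_biUnion_finset_le _ _) le_rfl
    _ ≤ (∑ la ∈ (Finset.univ : Finset (Fin (k + 1))) ×ˢ A, (w s(p la.1, la.2) : ℝ) *
          μ.real {ω : BondConfig (Fin n) | (A.filter fun z => ω ∈ openConn c z).card ≤ j}) + 0 :=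
        add_le_add (Finset.sum_le_sum hterm) le_rfl
    _ = _ := by rw [add_zero, Finset.sum_mul]

/-! ### Attachment along a weight-one chain -/

/-- Along a chain of open pairs `s(p m, p (m+1))`, `m < l`, the vertex `p 0` reaches `p l`. [folklore] -/
theorem reachable_chain {k : ℕ} (p : Fin (k + 1) → Fin n) (hpinj : Function.Injective p) {ω : BondConfig (Fin n)}
    (hopen : ∀ l : Fin k, s(p l.castSucc, p l.succ) ∈ ω) :
    ∀ l : Fin (k + 1), (openGraph ω).Reachable (p 0) (p l) := by
  intro l
  induction l using Fin.induction with
  | zero => exact SimpleGraph.Reachable.refl _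
  | succ l ih =>
    refine ih.trans (SimpleGraph.Adj.reachable ?_)
    rw [openGraph_adj]
    refine ⟨hopen l, fun h => ?_⟩
    have := congrArg Fin.val (hpinj h)
    simp at this

/-- **Attachment lower bound for a weight-one chain.**  If every path pair `s(p l, p (l+1))` has weight `1`, then
`1 − exp(−Σ_l Σ_{a∈A} w(p l, a)) ≤ μ(p 0 ↔ A)`. [this work] -/
theorem attach_ge_chain (w : Sym2 (Fin n) → unitInterval) (A : Finset (Fin n)) {k : ℕ}
    (p : Fin (k + 1) → Fin n) (hpinj : Function.Injective p) (hpA : ∀ i, p i ∉ A)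
    (hone : ∀ l : Fin k, w s(p l.castSucc, p l.succ) = 1) :
    1 - Real.exp (-(∑ la ∈ (Finset.univ : Finset (Fin (k + 1))) ×ˢ A, (w s(p la.1, la.2) : ℝ))) ≤
      (prodBernoulli w).real (⋃ a ∈ A, (openConn (p 0) a : Set (BondConfig (Fin n)))) := by
  set μ := prodBernoulli w with hμ
  set I : Finset (Fin (k + 1) × Fin n) := (Finset.univ : Finset (Fin (k + 1))) ×ˢ A with hI
  set F : Finset (Sym2 (Fin n)) := I.image fun la => s(p la.1, la.2) with hF
  set E : Finset (Sym2 (Fin n)) := (Finset.univ : Finset (Fin k)).image fun l => s(p l.castSucc, p l.succ) with hE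
  -- the hair map is injective on `I`
  have hinj : Set.InjOn (fun la : Fin (k + 1) × Fin n => s(p la.1, la.2)) ↑I := by
    intro la hla lb hlb h
    have ha : la.2 ∈ A := (Finset.mem_product.1 (Finset.mem_coe.1 hla)).2
    have hb : lb.2 ∈ A := (Finset.mem_product.1 (Finset.mem_coe.1 hlb)).2
    rcases Sym2.eq_iff.1 h with ⟨h1, h2⟩ | ⟨h1, h2⟩
    · exact Prod.ext (hpinj h1) h2
    · exact absurd hb (h1 ▸ hpA la.1)
  -- `{some hair open} \ {some chain pair closed} ⊆ {p 0 ↔ A}`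
  have hsub : {ω : BondConfig (Fin n) | ∀ e ∈ F, e ∉ ω}ᶜ ⊆
      (⋃ a ∈ A, (openConn (p 0) a : Set (BondConfig (Fin n)))) ∪ {ω : BondConfig (Fin n) | ∃ e ∈ E, e ∉ ω} := by
    intro ω hω
    rw [Set.mem_compl_iff, mem_setOf_eq] at hω
    push Not at hω
    obtain ⟨e, heF, heω⟩ := hω
    by_cases hch : ∃ e ∈ E, e ∉ ω
    · exact Or.inr hch
    left
    push Not at hch
    obtain ⟨la, hla, rfl⟩ := Finset.mem_image.1 heF
    have ha : la.2 ∈ A := (Finset.mem_product.1 hla).2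
    have hopen : ∀ l : Fin k, s(p l.castSucc, p l.succ) ∈ ω :=
      fun l => hch _ (Finset.mem_image.2 ⟨l, Finset.mem_univ _, rfl⟩)
    rw [Set.mem_iUnion₂]
    refine ⟨la.2, ha, ?_⟩
    have hne : p la.1 ≠ la.2 := fun h => hpA la.1 (h ▸ ha)
    have hadj : (openGraph ω).Adj (p la.1) la.2 := (openGraph_adj ω _ _).2 ⟨heω, hne⟩
    exact ((reachable_chain p hpinj hopen la.1).trans hadj.reachable : (openGraph ω).Reachable (p 0) la.2)
  -- the chain pairs are almost surely open
  have hnullE : μ.real {ω : BondConfig (Fin n) | ∃ e ∈ E, e ∉ ω} = 0 := by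
    refine le_antisymm ?_ measureReal_nonneg
    calc μ.real {ω : BondConfig (Fin n) | ∃ e ∈ E, e ∉ ω}
        ≤ μ.real (⋃ e ∈ E, {ω : BondConfig (Fin n) | e ∉ ω}) := by
          refine measureReal_mono (fun ω hω => ?_) (measure_ne_top _ _)
          obtain ⟨e, he, heω⟩ := hω
          exact Set.mem_iUnion₂.2 ⟨e, he, heω⟩
      _ ≤ ∑ e ∈ E, μ.real {ω : BondConfig (Fin n) | e ∉ ω} := measureReal_biUnion_finset_le _ _
      _ = 0 := by
          refine Finset.sum_eq_zero fun e he => ?_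
          obtain ⟨l, -, rfl⟩ := Finset.mem_image.1 he
          rw [prodBernoulli_real_setOf_notMem, hone l]
          simp
  -- probability of no open hair
  have hclosed : μ.real {ω : BondConfig (Fin n) | ∀ e ∈ F, e ∉ ω} = ∏ la ∈ I, (1 - (w s(p la.1, la.2) : ℝ)) := by
    rw [prodBernoulli_real_forall_notMem, hF, Finset.prod_image hinj]
  have hprod : ∏ la ∈ I, (1 - (w s(p la.1, la.2) : ℝ)) ≤ Real.exp (-(∑ la ∈ I, (w s(p la.1, la.2) : ℝ))) := by
    rw [← Finset.sum_neg_distrib, Real.exp_sum]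
    refine Finset.prod_le_prod (fun la _ => by linarith [(w s(p la.1, la.2)).2.2]) fun la _ => ?_
    have := Real.add_one_le_exp (-(w s(p la.1, la.2) : ℝ))
    linarith
  have hcompl : μ.real {ω : BondConfig (Fin n) | ∀ e ∈ F, e ∉ ω}ᶜ = 1 - μ.real {ω : BondConfig (Fin n) | ∀ e ∈ F, e ∉ ω} :=
    probReal_compl_eq_one_sub MeasurableSet.of_discrete
  calc 1 - Real.exp (-(∑ la ∈ I, (w s(p la.1, la.2) : ℝ)))
      ≤ 1 - μ.real {ω : BondConfig (Fin n) | ∀ e ∈ F, e ∉ ω} := by rw [hclosed]; linarith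
    _ = μ.real {ω : BondConfig (Fin n) | ∀ e ∈ F, e ∉ ω}ᶜ := hcompl.symm
    _ ≤ μ.real ((⋃ a ∈ A, (openConn (p 0) a : Set (BondConfig (Fin n)))) ∪ {ω : BondConfig (Fin n) | ∃ e ∈ E, e ∉ ω}) :=
        measureReal_mono hsub (measure_ne_top _ _)
    _ ≤ μ.real (⋃ a ∈ A, (openConn (p 0) a : Set (BondConfig (Fin n)))) + μ.real {ω : BondConfig (Fin n) | ∃ e ∈ E, e ∉ ω} :=
        measureReal_union_le _ _
    _ = _ := by rw [hnullE, add_zero]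

/-! ### The base case: a weight-one chain -/

/-- `1 − e^{−1/2} ≥ 1/3`. [folklore] -/
theorem one_sub_exp_neg_half_ge : (1 : ℝ) / 3 ≤ 1 - Real.exp (-(1 / 2)) := by
  have h := Real.add_one_le_exp ((1 : ℝ) / 2)
  have hpos := Real.exp_pos ((1 : ℝ) / 2)
  have hinv : (Real.exp (1 / 2))⁻¹ ≤ 2 / 3 := by
    rw [inv_le_comm₀ hpos (by norm_num)]
    linarith
  rw [Real.exp_neg]
  linarith

/-- For `0 ≤ H ≤ 1/2`: `H/2 ≤ 1 − e^{−H}`. [folklore] -/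
theorem half_le_one_sub_exp_neg {H : ℝ} (h0 : 0 ≤ H) (h1 : H ≤ 1 / 2) : H / 2 ≤ 1 - Real.exp (-H) := by
  have habs : |(-H)| ≤ 1 := by rw [abs_neg, abs_of_nonneg h0]; linarith
  have h := Real.abs_exp_sub_one_sub_id_le habs
  have h' := (abs_le.1 h).2
  nlinarith

/-- **Base case of conditional CIL: a weight-one chain with relay hairs.**  If every path pair has weight `1`, then
for every champion `c`:  `μ(1 ≤ N_{p 0} ≤ j) ≤ 3 · μ(p 0 ↔ A) · μ(N_c ≤ j)`. [this work] -/
theorem condCIL_chain (w : Sym2 (Fin n) → unitInterval) (A : Finset (Fin n)) (j : ℕ) {k : ℕ}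
    (p : Fin (k + 1) → Fin n) (hpinj : Function.Injective p) (hpA : ∀ i, p i ∉ A)
    (hpath : ∀ (i : Fin (k + 1)) (v : Fin n), v ∉ A → v ≠ p i → 0 < (w s(p i, v) : ℝ) →
      ∃ l : Fin (k + 1), v = p l ∧ (l.val = i.val + 1 ∨ i.val = l.val + 1))
    (hone : ∀ l : Fin k, w s(p l.castSucc, p l.succ) = 1)
    (c : Fin n) (hc : c ∈ A) (hchamp : ∀ a ∈ A,
      (prodBernoulli w).real {ω : BondConfig (Fin n) | (A.filter fun z => ω ∈ openConn a z).card ≤ j} ≤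
        (prodBernoulli w).real {ω : BondConfig (Fin n) | (A.filter fun z => ω ∈ openConn c z).card ≤ j}) :
    (prodBernoulli w).real {ω : BondConfig (Fin n) | 1 ≤ (A.filter fun z => ω ∈ openConn (p 0) z).card ∧
        (A.filter fun z => ω ∈ openConn (p 0) z).card ≤ j} ≤
      3 * (prodBernoulli w).real (⋃ a ∈ A, (openConn (p 0) a : Set (BondConfig (Fin n)))) *
        (prodBernoulli w).real {ω : BondConfig (Fin n) | (A.filter fun z => ω ∈ openConn c z).card ≤ j} := by
  set μ := prodBernoulli w with hμ
  set H : ℝ := ∑ la ∈ (Finset.univ : Finset (Fin (k + 1))) ×ˢ A, (w s(p la.1, la.2) : ℝ) with hH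
  set M : ℝ := μ.real {ω : BondConfig (Fin n) | (A.filter fun z => ω ∈ openConn c z).card ≤ j} with hM
  set att : ℝ := μ.real (⋃ a ∈ A, (openConn (p 0) a : Set (BondConfig (Fin n)))) with hatt
  have hH0 : 0 ≤ H := Finset.sum_nonneg fun la _ => (w _).2.1
  have hM0 : 0 ≤ M := measureReal_nonneg
  have hatt_ge : 1 - Real.exp (-H) ≤ att := attach_ge_chain w A p hpinj hpA hone
  by_cases hthin : H ≤ 1 / 2
  · -- thin: route bound `≤ H · M`, attachment `≥ H/2`
    have h1 : μ.real {ω : BondConfig (Fin n) | 1 ≤ (A.filter fun z => ω ∈ openConn (p 0) z).card ∧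
        (A.filter fun z => ω ∈ openConn (p 0) z).card ≤ j} ≤ H * M :=
      lowerTail_le_hairWeight_mul w A j p hpA hpath c hchamp
    have h2 : H / 2 ≤ att := (half_le_one_sub_exp_neg hH0 hthin).trans hatt_ge
    nlinarith
  · -- fat: unconditional CIL `≤ M`, attachment `≥ 1/3`
    push Not at hthin
    have h1 : μ.real {ω : BondConfig (Fin n) | 1 ≤ (A.filter fun z => ω ∈ openConn (p 0) z).card ∧
        (A.filter fun z => ω ∈ openConn (p 0) z).card ≤ j} ≤ M :=
      cil_steinerPath A j k w p hpinj hpA hpath c hc hchamp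
    have hexp : Real.exp (-H) ≤ Real.exp (-(1 / 2)) := Real.exp_le_exp.2 (by linarith)
    have h2 : (1 : ℝ) / 3 ≤ att := by linarith [one_sub_exp_neg_half_ge]
    nlinarith

end CondCIL

end

end Summit.CriticalPhenomena.PercolationContinuityZ3.Theorems
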